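import Mathlib
import Literature.Analysis.FluidPDE.Tao2016AveragedNS.RenormalisedCascadeWaves

/-!
# The DSS dictionary: a discretely self-similar lattice orbit in PHYSICAL time gives an S-wave profile

Cell harvest/h2-tao-ladder, seat p2 g6 (NUM-4b, STAGE 2, `rung1/STAGE2-LEMMA.md` Lemma 3), kernel
form.  MODEL statement about lattice profile equations; nothing here concerns the Navier–Stokes
equations.

Setting: an abstract nearest-neighbour lattice `u̇_k = λ^k (Q(u_k) + A₀(u_{k-1}) + B₀(u_{k+1}, u_k))`
with `Q`, `A₀` homogeneous of degree two and `B₀` homogeneous of degree one in each slot (Tao's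
circuit and every cancelling four-mode table are of this form).  A DISCRETELY SELF-SIMILAR orbit
with blow-up time `t⋆`, amplitude factor `g⁻¹` and time factor `e^{T} = λ/g` per shell satisfies
`U_{k}(t⋆ - θ) = g⁻¹ U_{k-1}(t⋆ - e^{T} θ)`; only shells `-1, 0, 1` and the law at shell `0` are
needed.  CONCLUSION: `Φ(x) := e^{-x} U_0(t⋆ - e^{-x})` is a single-profile S-wave
(`IsSWave (Equiv.refl _) Q (λ • A₀) B₀ 1 λ λ⁻¹ T`) — the profile system of `IsDSSWave` with the
tree's convention (feed `Λ·A`, drain `Λ⁻¹·B`, damping `1`).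
-/

noncomputable section

namespace Literature.Analysis.FluidPDE.TaoCascade

variable {V : Type*} [NormedAddCommGroup V] [InnerProductSpace ℝ V]

/-- **DSS dictionary (physical time → log-time profile).**  If shell `0` of the lattice obeys
`U₀' = Q(U₀) + A₀(U₋₁) + B₀(U₁, U₀)` before the blow-up time `t⋆`, the neighbouring shells are the
DSS images of shell `0` (`U₋₁(t⋆ - θ) = g • U₀(t⋆ - e^{-T} θ)`, `U₁(t⋆ - θ) = g⁻¹ • U₀(t⋆ - e^{T} θ)`
for `θ > 0`) and `λ = g e^{T}`, then `Φ(x) = e^{-x} • U₀(t⋆ - e^{-x})` solves the single-profile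
S-wave system `Φ' = -Φ + Q(Φ) + λ·(λ A₀)(Φ(·+T)) + λ⁻¹·B₀(Φ(·-T), Φ)`.
[cite: Tao2016AveragedNS, §5.3–§6 (the self-similar ansatz behind Theorem 6.6's blow-up); cell harvest/h2-tao-ladder rung1/STAGE2-LEMMA.md Lemma 3 (dictionary `X_n(t) = Λ^{-n} e^{s} Φ(s - nT)`, `s = -log(t⋆ - t)`)] -/
theorem isSWave_of_dssOrbit
    {Q A₀ : V → V} {B₀ : V → V → V}
    (hQ : ∀ (c : ℝ) (v : V), Q (c • v) = c ^ 2 • Q v)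
    (hA : ∀ (c : ℝ) (v : V), A₀ (c • v) = c ^ 2 • A₀ v)
    (hB1 : ∀ (c : ℝ) (v w : V), B₀ (c • v) w = c • B₀ v w)
    (hB2 : ∀ (c : ℝ) (v w : V), B₀ v (c • w) = c • B₀ v w)
    {g lam T tstar : ℝ} (hg : 0 < g) (hlam : lam = g * Real.exp T)
    {U₀ Um Up : ℝ → V}
    (hU : ∀ t, t < tstar → HasDerivAt U₀ (Q (U₀ t) + A₀ (Um t) + B₀ (Up t) (U₀ t)) t)
    (hm : ∀ θ, 0 < θ → Um (tstar - θ) = g • U₀ (tstar - Real.exp (-T) * θ))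
    (hp : ∀ θ, 0 < θ → Up (tstar - θ) = g⁻¹ • U₀ (tstar - Real.exp T * θ)) :
    IsSWave (Equiv.refl Unit) Q (fun v => lam • A₀ v) B₀ 1 lam lam⁻¹ T
      (fun _ x => Real.exp (-x) • U₀ (tstar - Real.exp (-x))) := by
  intro r x
  have hθ : 0 < Real.exp (-x) := Real.exp_pos _
  have hg0 : g ≠ 0 := ne_of_gt hg
  have hET : Real.exp T ≠ 0 := (Real.exp_pos T).ne'
  -- derivative of the scalar factor y ↦ e^{-y}
  have hexp : HasDerivAt (fun y : ℝ => Real.exp (-y)) (-Real.exp (-x)) x := by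
    have h1 : HasDerivAt (fun y : ℝ => Real.exp (-y)) (Real.exp (-x) * (-1)) x :=
      (Real.hasDerivAt_exp (-x)).comp x ((hasDerivAt_id x).neg)
    convert h1 using 1
    ring
  -- derivative of the inner map y ↦ t⋆ - e^{-y}
  have hh : HasDerivAt (fun y : ℝ => tstar - Real.exp (-y)) (Real.exp (-x)) x := by
    have h2 := hexp.const_sub tstar
    simp only [neg_neg] at h2
    exact h2
  -- U₀ ∘ inner map
  have hlt : tstar - Real.exp (-x) < tstar := by linarith
  have hcomp : HasDerivAt (fun y : ℝ => U₀ (tstar - Real.exp (-y)))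
      (Real.exp (-x) • (Q (U₀ (tstar - Real.exp (-x))) + A₀ (Um (tstar - Real.exp (-x)))
        + B₀ (Up (tstar - Real.exp (-x))) (U₀ (tstar - Real.exp (-x))))) x :=
    (hU (tstar - Real.exp (-x)) hlt).scomp x hh
  have hder := hexp.smul hcomp
  refine hder.congr_deriv ?_
  -- the two neighbours through the DSS relations, at θ = e^{-x}
  have hUm : Um (tstar - Real.exp (-x)) = g • U₀ (tstar - Real.exp (-T) * Real.exp (-x)) :=
    hm _ hθ
  have hUp : Up (tstar - Real.exp (-x)) = g⁻¹ • U₀ (tstar - Real.exp T * Real.exp (-x)) :=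
    hp _ hθ
  have hxT : Real.exp (-(x + T)) = Real.exp (-T) * Real.exp (-x) := by
    rw [show -(x + T) = -T + -x by ring, Real.exp_add]
  have hxT' : Real.exp (-(x - T)) = Real.exp T * Real.exp (-x) := by
    rw [show -(x - T) = T + -x by ring, Real.exp_add]
  simp only [one_smul]
  rw [hxT, hxT', hUm, hUp]
  simp only [hQ, hA, hB1, hB2, smul_add, smul_smul, neg_smul]
  have hEmT : Real.exp (-T) = (Real.exp T)⁻¹ := Real.exp_neg T
  rw [hEmT]
  subst hlam
  match_scalars <;> field_simp

/-- **Scaling symmetry of the abstract nearest-neighbour cascade lattice** (`rung1/STAGE2-LEMMA.md`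
Lemma 1).  If `U_k` solves `U_k' = λ^k (Q(U_k) + A₀(U_{k-1}) + B₀(U_{k+1}, U_k))` at the time `λγt`
(shells `k-2, k-1, k`), with `Q`, `A₀` homogeneous of degree two and `B₀` of degree one in each
slot, then the shifted–rescaled family `(σ_γ U)_k(t) := γ • U_{k-1}(λ γ t)` solves the same lattice
at shell `k` and time `t`.  With `γ = g⁻¹` this turns a one-shift datum (renormalise ∘ shift ∘ flow =
identity) into the discretely self-similar continuation used by `isSWave_of_dssOrbit`.
[cite: Tao2016AveragedNS, §5.3–§6 (scale covariance of the cascade; the self-similar ansatz); cell harvest/h2-tao-ladder rung1/STAGE2-LEMMA.md Lemma 1] -/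
theorem hasDerivAt_rescale_shift
    {Q A₀ : V → V} {B₀ : V → V → V}
    (hQ : ∀ (c : ℝ) (v : V), Q (c • v) = c ^ 2 • Q v)
    (hA : ∀ (c : ℝ) (v : V), A₀ (c • v) = c ^ 2 • A₀ v)
    (hB1 : ∀ (c : ℝ) (v w : V), B₀ (c • v) w = c • B₀ v w)
    (hB2 : ∀ (c : ℝ) (v w : V), B₀ v (c • w) = c • B₀ v w)
    {lam γ : ℝ} (hlam : lam ≠ 0) {U : ℤ → ℝ → V} {k : ℤ} {t : ℝ}
    (hU : HasDerivAt (U (k - 1))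
      (lam ^ (k - 1) • (Q (U (k - 1) (lam * γ * t)) + A₀ (U (k - 2) (lam * γ * t))
        + B₀ (U k (lam * γ * t)) (U (k - 1) (lam * γ * t)))) (lam * γ * t)) :
    HasDerivAt (fun s : ℝ => γ • U (k - 1) (lam * γ * s))
      (lam ^ k • (Q (γ • U (k - 1) (lam * γ * t)) + A₀ (γ • U (k - 2) (lam * γ * t))
        + B₀ (γ • U k (lam * γ * t)) (γ • U (k - 1) (lam * γ * t)))) t := by
  -- inner linear map s ↦ λγ s
  have hlin : HasDerivAt (fun s : ℝ => lam * γ * s) (lam * γ) t := by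
    simpa using (hasDerivAt_id t).const_mul (lam * γ)
  have hcomp := hU.scomp t hlin
  have hsc := hcomp.const_smul γ
  refine hsc.congr_deriv ?_
  simp only [hQ, hA, hB1, hB2, smul_add, smul_smul]
  have hk : lam ^ k = lam ^ (k - 1) * lam := by
    rw [← zpow_add_one₀ hlam, sub_add_cancel]
  rw [hk]
  match_scalars <;> ring


end Literature.Analysis.FluidPDE.TaoCascade
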